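import Mathlib.RingTheory.Jacobson.Ring
import Mathlib.RingTheory.MvPolynomial.Localization
import Mathlib.RingTheory.Localization.FractionRing
import Mathlib.RingTheory.Localization.Ideal
import Mathlib.FieldTheory.IsAlgClosed.Basic
import Literature.Barriers.ValiantsHypothesis.NoncommutativeExtensions
import HarnessLib

/-!
# Hrubeš–Yehudayoff 2011, Thm. 3.2 / Cor. 3.3 and the barrier — the discharges, under the
canonical `_holds` names; Thm. 3.4 (formula half) — proof

`NoncommutativeExtensions.lean` vendors Thm. 3.2 and Cor. 3.3 of Hrubeš–Yehudayoff as the named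
facts `HrubesYehudayoff2011_thm32` / `HrubesYehudayoff2011_cor33` (commutative base ring `R`;
`R' ⊇ R` an `R`-algebra with injective structure map, i.e. `R` central in `R'`; `O(dn)` as a
uniform `c · (dn + 1)`; "degree `d`" as total degree `≤ d`) and the barrier
`NoncommutativeExtensions` (no extension-robust formula lower bound exceeds `6dn + 1`), and PROVES
there the explicit bound behind all three: `L_{R'}(f) ≤ 6dn + 1` over the one ring
`R' = HYRing R ⊇ R` (`ncFormulaSize_baseChange_le`, `algebraMap_hyRing_injective`). The first part
of this file DISCHARGES the three facts under the tree-wide canonical names `<Fact>_holds` (exact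
case of the fact's name, CONVENTIONS.md §4) — `HrubesYehudayoff2011_thm32_holds`,
`HrubesYehudayoff2011_cor33_holds`, `NoncommutativeExtensions_holds` — each in three to five lines
from `ncFormulaSize_baseChange_le` with `c = 6` and `R' = HYRing R`; no statement is changed and
nothing new is claimed there. (Each fact has exactly this one discharge: the lowerCamel twins
`hrubesYehudayoff2011_thm32_holds`, `hrubesYehudayoff2011_cor33_holds`,
`noncommutativeExtensions_holds` once carried by `NoncommutativeExtensions.lean` are retired as
duplicates, ledger item dedup-00193.) The second part PROVES the named fact
`HrubesYehudayoff2011_thm34_formulas` (Thm. 3.4, formula half) of the same file, see below.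

Print (Theory of Computing 7 (2011), p. 122): "Theorem 3.2. Let `R` be a ring. Let `f ∈ R[X]` be
a polynomial of degree `d` (recall `|X| = n`). Then there exists `R⋆ ⊇ R` such that
`L_{R⋆}(f) = O(dn)`."; (p. 123): "Corollary 3.3. Let `R` be a ring. Then there exists a ring
`R̄ ⊇ R` such that for every `f ∈ R[X]` of degree `d`, `L_{R̄}(f) = O(dn)`. The ring `R̄` depends
neither on `f` nor on `d`, and it has infinite dimension over `R`."

## Thm. 3.4 (formula half): commutative extensions do not help over an algebraically closed
field — the proof (appended)

Discharge of the named fact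
`Literature.Barriers.ValiantsHypothesis.HrubesYehudayoff2011_thm34_formulas` of
`NoncommutativeExtensions.lean` (Hrubeš–Yehudayoff, *Arithmetic complexity in ring
extensions*, Theory of Computing 7 (2011) 119–129, Thm. 3.4, p. 124): "Assume that `F` is an
algebraically closed field. Let `R` be a subring of `F` and let `R' ⊇ R` be a commutative ring.
Then for every `f ∈ R[X]`, we have `C_F(f) ≤ C_{R'}(f)` and `L_F(f) ≤ L_{R'}(f)`" — the formula
half, in the tree's model `NCFormula` / `ncFormulaSize` / `baseChange`.

**The printed proof** (p. 124). "Let `Φ` be a circuit over `R'` computing `f`. Assume that `Φ`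
contains `a_1, …, a_k ∈ R' ∖ R`. Let us introduce new variables `z_1, …, z_k`. Let `Φ'` be the
circuit obtained from `Φ` by replacing every `a_i` by `z_i`. Thus `Φ'` defines a polynomial `F`
... Let `I ⊆ S` be the ideal generated by the polynomials `F_J − f_J`. (Recall that `F_J` and
`f_J` are the coefficients of the monomial `x^J` in `F` and `f` respectively.) The ideal `I` does
not contain `1`. This is because the equations `F_J(z_1, …, z_k) − f_J = 0` have a common solution
`a_1, …, a_k` in `R'`, and so every polynomial `h` in `I` satisfies `h(a_1, …, a_k) = 0`. Since
`1 ∉ I`, Hilbert's “Weak Nullstellensatz” tells us that there exist `v_1, …, v_k ∈ F` such that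
for every `J`, `F_J(v_1, …, v_k) = f_J`. Let `Φ''` be the circuit obtained by replacing every
`z_i` in `Φ'` by `v_i ∈ F`. Thus `Φ''` computes the polynomial `f`, and the size of `Φ''` is the
same as the size of `Φ`."

**The tree's rendering of the proof.** `NCFormula.map g` substitutes constants leaf by leaf
(size is unchanged, `NCFormula.size_map`; semantics along a ring map, `NCFormula.eval_map`);
the generic formula replaces EVERY constant `c` of `Φ` (the finite set `NCFormula.consts Φ`) by
the indeterminate `y_c` of `P = R[y_c : c ∈ consts Φ]`, and substituting `y_c ↦ c` gives back
`Φ` (`NCFormula.map_congr`). The Nullstellensatz step is isolated as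
`exists_algHom_of_injective`: for `R ⊆ F` (`F` algebraically closed), `R ⊆ R'` commutative and an
`R`-algebra map `χ : R[Y] → R'` (`Y` finite; here `y_c ↦ c`), there is an `R`-algebra map
`ψ : R[Y] → F` vanishing wherever `χ` does. Its proof makes the printed "1 ∉ I" precise over a
base RING `R`: `ker χ` avoids the nonzero constants `R ∖ 0` (injectivity of `R → R'`), hence
(`K = Frac R`, and `K[Y]` being the localisation of `R[Y]` at those constants,
`MvPolynomial.isLocalization`) its extension to `K[Y]` is proper
(`IsLocalization.map_algebraMap_ne_top_iff_disjoint`); a maximal ideal above it has residue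
field finite over `K` (Zariski's form of the weak Nullstellensatz,
`finite_of_finite_type_of_isJacobsonRing`), which embeds into `F` over `K` (`IsAlgClosed.lift`,
`IsFractionRing.lift`). Applying `ψ` to the generic formula yields a formula over `F` of the size
of `Φ` computing `f` (`exists_ncFormula_baseChange_of_comm`), whence `L_F(f) ≤ L_{R'}(f)`
(`HrubesYehudayoff2011_thm34_formulas_holds`).

## References

* [HrubesYehudayoff2011] P. Hrubeš, A. Yehudayoff, *Arithmetic complexity in ring extensions*,
  Theory of Computing 7 (2011) 119–129, Thm. 3.2 (p. 122), Cor. 3.3 (p. 123); Prop. 3.1 (proof: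
  substitution of constants, p. 122), Thm. 3.4 and its proof (p. 124).
-/

namespace Literature.Barriers.ValiantsHypothesis

universe u

/-- **Hrubeš–Yehudayoff 2011, Thm. 3.2 holds** (commutative base ring, as vendored): with
`c = 6` and `R' = HYRing R ⊇ R` (`R` central, `algebraMap_hyRing_injective`),
`L_{R'}(f) ≤ 6 (dn + 1)` for every `f ∈ R[x_1, …, x_n]` of total degree `≤ d`, from
`L_{R'}(f) ≤ 6dn + 1` (`ncFormulaSize_baseChange_le`). [cite: HrubesYehudayoff2011, Thm. 3.2] -/
theorem HrubesYehudayoff2011_thm32_holds : HrubesYehudayoff2011_thm32.{u} := by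
  refine ⟨6, fun R _ n d f hd => ⟨HYRing R, inferInstance, inferInstance,
    algebraMap_hyRing_injective R, ?_⟩⟩
  have := ncFormulaSize_baseChange_le d f hd
  nlinarith [this]

/-- **Hrubeš–Yehudayoff 2011, Cor. 3.3 holds** (commutative base ring, as vendored): ONE ring
`R' = HYRing R` for all `n`, `d`, `f`, with `c = 6` (`ncFormulaSize_baseChange_le`,
`algebraMap_hyRing_injective`). [cite: HrubesYehudayoff2011, Cor. 3.3] -/
theorem HrubesYehudayoff2011_cor33_holds : HrubesYehudayoff2011_cor33.{u} := by
  refine ⟨6, fun R _ => ⟨HYRing R, inferInstance, inferInstance, algebraMap_hyRing_injective R,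
    fun n d f hd => ?_⟩⟩
  have := ncFormulaSize_baseChange_le d f hd
  nlinarith [this]

/-- **The barrier holds**: no `ExtensionRobustLowerBound R f s` with `s > 6dn + 1` for `f` of total
degree `≤ d` in `n` variables — such a bound would in particular hold over `R' = HYRing R`
(`algebraMap_hyRing_injective`), where `L_{R'}(f) ≤ 6dn + 1` (`ncFormulaSize_baseChange_le`).
[cite: HrubesYehudayoff2011, Thm. 3.2 and Cor. 3.3] -/
theorem NoncommutativeExtensions_holds : NoncommutativeExtensions.{u} := by
  intro R _ n d f hd s hs h
  have h1 := h (HYRing R) (algebraMap_hyRing_injective R)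
  have h2 := ncFormulaSize_baseChange_le d f hd
  omega

/-! ## Thm. 3.4 (formula half): the proof -/

noncomputable section

open AddMonoidAlgebra

universe v w

/-! ### Substitution of constants in a formula -/

namespace NCFormula

variable {A : Type u} {B : Type w} {σ : Type v}

/-- **Substitution of constants**: the formula `Φ` "after substituting each constant `a ∈ A` by
`g(a) ∈ B`" (same tree, leaves relabelled).
[cite: HrubesYehudayoff2011, Prop. 3.1 (proof) and Thm. 3.4 (proof)] -/
def map (g : A → B) : NCFormula A σ → NCFormula B σ
  | var i => var i
  | const c => const (g c)
  | add φ ψ => add (map g φ) (map g ψ)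
  | mul φ ψ => mul (map g φ) (map g ψ)

/-- Unfolding of `map`. [folklore] -/
@[simp] theorem map_var (g : A → B) (i : σ) : (var i : NCFormula A σ).map g = var i := rfl
/-- Unfolding of `map`. [folklore] -/
@[simp] theorem map_const (g : A → B) (c : A) : (const c : NCFormula A σ).map g = const (g c) :=
  rfl
/-- Unfolding of `map`. [folklore] -/
@[simp] theorem map_add (g : A → B) (φ ψ : NCFormula A σ) :
    (add φ ψ).map g = add (φ.map g) (ψ.map g) := rfl
/-- Unfolding of `map`. [folklore] -/
@[simp] theorem map_mul (g : A → B) (φ ψ : NCFormula A σ) :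
    (mul φ ψ).map g = mul (φ.map g) (ψ.map g) := rfl

/-- Substituting constants does not change the size ("the size of `Φ''` is the same as the size
of `Φ`"). [cite: HrubesYehudayoff2011, Thm. 3.4 (proof)] -/
@[simp] theorem size_map (g : A → B) (φ : NCFormula A σ) : (φ.map g).size = φ.size := by
  induction φ with
  | var i => rfl
  | const c => rfl
  | add φ ψ ihφ ihψ => simp [ihφ, ihψ]
  | mul φ ψ ihφ ihψ => simp [ihφ, ihψ]

/-- Substitutions compose. [folklore] -/
theorem map_map {C : Type*} (g : A → B) (h : B → C) (φ : NCFormula A σ) :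
    (φ.map g).map h = φ.map (h ∘ g) := by
  induction φ with
  | var i => rfl
  | const c => rfl
  | add φ ψ ihφ ihψ => simp [ihφ, ihψ]
  | mul φ ψ ihφ ihψ => simp [ihφ, ihψ]

/-- The identity substitution. [folklore] -/
@[simp] theorem map_id' (φ : NCFormula A σ) : φ.map (fun c => c) = φ := by
  induction φ with
  | var i => rfl
  | const c => rfl
  | add φ ψ ihφ ihψ => simp [ihφ, ihψ]
  | mul φ ψ ihφ ihψ => simp [ihφ, ihψ]

/-- **The constants of a formula**: the (finite) set of ring elements labelling its leaves
("Assume that `Φ` contains `a_1, …, a_k ∈ R'`"). [cite: HrubesYehudayoff2011, Thm. 3.4 (proof)] -/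
def consts [DecidableEq A] : NCFormula A σ → Finset A
  | var _ => ∅
  | const c => {c}
  | add φ ψ => consts φ ∪ consts ψ
  | mul φ ψ => consts φ ∪ consts ψ

/-- Unfolding of `consts`. [folklore] -/
@[simp] theorem consts_var [DecidableEq A] (i : σ) : (var i : NCFormula A σ).consts = ∅ := rfl
/-- Unfolding of `consts`. [folklore] -/
@[simp] theorem consts_const [DecidableEq A] (c : A) : (const c : NCFormula A σ).consts = {c} :=
  rfl
/-- Unfolding of `consts`. [folklore] -/
@[simp] theorem consts_add [DecidableEq A] (φ ψ : NCFormula A σ) :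
    (add φ ψ).consts = φ.consts ∪ ψ.consts := rfl
/-- Unfolding of `consts`. [folklore] -/
@[simp] theorem consts_mul [DecidableEq A] (φ ψ : NCFormula A σ) :
    (mul φ ψ).consts = φ.consts ∪ ψ.consts := rfl

/-- Two substitutions agreeing on the constants of `φ` give the same formula. [folklore] -/
theorem map_congr [DecidableEq A] {g g' : A → B} {φ : NCFormula A σ}
    (h : ∀ c ∈ φ.consts, g c = g' c) : φ.map g = φ.map g' := by
  induction φ with
  | var i => rfl
  | const c => simp [h c (by simp)]
  | add φ ψ ihφ ihψ =>
    simp only [consts_add, Finset.mem_union] at h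
    rw [map_add, map_add, ihφ fun c hc => h c (Or.inl hc), ihψ fun c hc => h c (Or.inr hc)]
  | mul φ ψ ihφ ihψ =>
    simp only [consts_mul, Finset.mem_union] at h
    rw [map_mul, map_mul, ihφ fun c hc => h c (Or.inl hc), ihψ fun c hc => h c (Or.inr hc)]

variable [Semiring A] [Semiring B]

/-- **Semantics of substitution along a ring map**: substituting `g(a)` for each constant `a`
computes the image polynomial `f^g` ("Thus `Ψ` computes `f_H`").
[cite: HrubesYehudayoff2011, Prop. 3.1 (proof)] -/
theorem eval_map {G : Type*} [FunLike G A B] [RingHomClass G A B] (g : G) (φ : NCFormula A σ) :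
    (φ.map g).eval = AddMonoidAlgebra.mapRingHom (σ →₀ ℕ) (g : A →+* B) φ.eval := by
  induction φ with
  | var i => simp
  | const c => simp
  | add φ ψ ihφ ihψ => simp [ihφ, ihψ]
  | mul φ ψ ihφ ihψ => simp [ihφ, ihψ]

end NCFormula

/-! ### The weak Nullstellensatz over a subring of an algebraically closed field -/

section Nullstellensatz

open MvPolynomial

/-- **Specialising an `R'`-point to an `F`-point** (the Nullstellensatz step of the proof of
Thm. 3.4, made precise over a base ring): let `R ⊆ F` with `F` an algebraically closed field,
let `R ⊆ R'` with `R'` commutative, and let `χ : R[Y] → R'` be an `R`-algebra map (`Y` finite;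
"the equations ... have a common solution `a_1, …, a_k` in `R'`"). Then there is an `R`-algebra
map `ψ : R[Y] → F` with `ψ(h) = 0` whenever `χ(h) = 0` ("there exist `v_1, …, v_k ∈ F` such that
for every `J`, `F_J(v_1, …, v_k) = f_J`"). Proof: `ker χ` contains no nonzero constant, so its
extension to `K[Y]` (`K = Frac R`, a localisation of `R[Y]`) is proper; a maximal ideal above it
has residue field finite over `K` (Zariski), which embeds into `F` over `K`.
[cite: HrubesYehudayoff2011, Thm. 3.4 (proof)] -/
theorem exists_algHom_of_injective {R : Type*} [CommRing R] {F : Type*} [Field F]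
    [IsAlgClosed F] [Algebra R F] (hF : Function.Injective (algebraMap R F))
    {R' : Type*} [CommRing R'] [Algebra R R'] (hR' : Function.Injective (algebraMap R R'))
    {ι : Type*} [Finite ι] (χ : MvPolynomial ι R →ₐ[R] R') :
    ∃ ψ : MvPolynomial ι R →ₐ[R] F, ∀ p, χ p = 0 → ψ p = 0 := by
  haveI : IsDomain R := hF.isDomain (algebraMap R F)
  let K := FractionRing R
  let PK := MvPolynomial ι K
  -- `K[Y]` as an `R[Y]`-algebra (Mathlib's non-global instance), a localisation of `R[Y]`
  letI : Algebra (MvPolynomial ι R) PK := MvPolynomial.algebraMvPolynomial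
  -- `ker χ` avoids the nonzero constants
  have hdisj : Disjoint
      (((nonZeroDivisors R).map (C : R →+* MvPolynomial ι R) : Submonoid (MvPolynomial ι R)) :
        Set (MvPolynomial ι R))
      (RingHom.ker χ : Set (MvPolynomial ι R)) := by
    rw [Set.disjoint_left]
    rintro p ⟨r, hr, rfl⟩ hp
    have h1 : χ (C r) = 0 := hp
    rw [← MvPolynomial.algebraMap_eq, AlgHom.commutes] at h1
    exact nonZeroDivisors.ne_zero hr (hR' (by rw [h1, map_zero]))
  -- hence its extension to `K[Y]` is a proper ideal
  have hne : (RingHom.ker χ).map (algebraMap (MvPolynomial ι R) PK) ≠ ⊤ :=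
    (IsLocalization.map_algebraMap_ne_top_iff_disjoint
      ((nonZeroDivisors R).map (C : R →+* MvPolynomial ι R)) PK _).mpr hdisj
  obtain ⟨mx, hmx, hle⟩ := Ideal.exists_le_maximal _ hne
  -- residue field: finite over `K` (Zariski), embeds into `F` over `K`
  let L := PK ⧸ mx
  letI : Field L := Ideal.Quotient.field mx
  haveI : Algebra.FiniteType K L :=
    Algebra.FiniteType.of_surjective (Ideal.Quotient.mkₐ K mx) (Ideal.Quotient.mkₐ_surjective K mx)
  haveI : Module.Finite K L := finite_of_finite_type_of_isJacobsonRing K L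
  haveI : Algebra.IsAlgebraic K L := Algebra.IsAlgebraic.of_finite K L
  letI : Algebra K F := (IsFractionRing.lift hF : K →+* F).toAlgebra
  let ψ : L →ₐ[K] F := IsAlgClosed.lift
  let θ : MvPolynomial ι R →+* F :=
    ψ.toRingHom.comp ((Ideal.Quotient.mk mx).comp (algebraMap (MvPolynomial ι R) PK))
  have hθ : ∀ r : R, θ (algebraMap R (MvPolynomial ι R) r) = algebraMap R F r := by
    intro r
    have h1 : algebraMap (MvPolynomial ι R) PK (algebraMap R (MvPolynomial ι R) r) =
        algebraMap K PK (algebraMap R K r) := by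
      rw [MvPolynomial.algebraMap_def, MvPolynomial.algebraMap_eq, MvPolynomial.map_C,
        MvPolynomial.algebraMap_eq]
    have h2 : algebraMap K F (algebraMap R K r) = algebraMap R F r :=
      IsFractionRing.lift_algebraMap hF r
    simp only [θ, RingHom.coe_comp, Function.comp_apply]
    rw [h1, Ideal.Quotient.mk_algebraMap, AlgHom.toRingHom_eq_coe, RingHom.coe_coe, AlgHom.commutes,
      h2]
  refine ⟨⟨θ, hθ⟩, fun p hp => ?_⟩
  have h3 : Ideal.Quotient.mk mx (algebraMap (MvPolynomial ι R) PK p) = 0 :=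
    Ideal.Quotient.eq_zero_iff_mem.mpr (hle (Ideal.mem_map_of_mem _ ((RingHom.mem_ker).mpr hp)))
  show θ p = 0
  simp only [θ, RingHom.coe_comp, Function.comp_apply, h3, map_zero]

end Nullstellensatz

/-! ### Transfer of a formula from `R'` to `F` -/

section Transfer

open MvPolynomial

variable {R : Type u} [CommRing R] {F : Type u} [Field F] [IsAlgClosed F] [Algebra R F]
  {R' : Type u} [CommRing R'] [Algebra R R'] {n : ℕ}

/-- **The transfer** (proof of Thm. 3.4 for formulas): if `R ⊆ F` (algebraically closed),
`R ⊆ R'` (commutative) and `Φ` is a formula over `R'` computing `f ∈ R[X]`, then some formula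
over `F` of the same size computes `f`. The constants of `Φ` are replaced by indeterminates
`y_c`; the `R`-algebra map `y_c ↦ c` kills every coefficient of `F_J − f_J`, hence so does some
`R`-algebra map `R[Y] → F` (`exists_algHom_of_injective`), and substituting its values for the
`y_c` gives the formula over `F`. [cite: HrubesYehudayoff2011, Thm. 3.4 (proof)] -/
theorem exists_ncFormula_baseChange_of_comm (hF : Function.Injective (algebraMap R F))
    (hR' : Function.Injective (algebraMap R R')) (f : MvPolynomial (Fin n) R)
    (Φ : NCFormula R' (Fin n)) (hΦ : Φ.eval = baseChange R' f) :
    ∃ Φ' : NCFormula F (Fin n), Φ'.eval = baseChange F f ∧ Φ'.size = Φ.size := by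
  classical
  -- the generic formula: every constant `c` becomes the indeterminate `y_c`
  let s : Finset R' := Φ.consts
  let y : R' → MvPolynomial ↥s R := fun c => if h : c ∈ s then X ⟨c, h⟩ else 0
  let Ψ : NCFormula (MvPolynomial ↥s R) (Fin n) := Φ.map y
  -- substituting `y_c ↦ c` gives back `Φ`
  let χ : MvPolynomial ↥s R →ₐ[R] R' := aeval (fun c : ↥s => (c : R'))
  have hχy : ∀ c ∈ Φ.consts, χ (y c) = c := by
    intro c hc
    simp only [y, χ, dif_pos (show c ∈ s from hc), aeval_X]
  have hΨΦ : Ψ.map χ = Φ := by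
    rw [NCFormula.map_map]
    conv_rhs => rw [← NCFormula.map_id' Φ]
    exact NCFormula.map_congr fun c hc => hχy c hc
  -- so `χ` kills every coefficient of `Ψ.eval - f`
  have hcoeff : ∀ m : Fin n →₀ ℕ,
      χ (Ψ.eval.coeff m) = algebraMap R R' (MvPolynomial.coeff m f) := by
    intro m
    have h1 := congrArg (fun g : AddMonoidAlgebra R' (Fin n →₀ ℕ) => g.coeff m)
      ((NCFormula.eval_map χ Ψ).symm.trans (by rw [hΨΦ, hΦ]))
    simpa [AddMonoidAlgebra.coeff_mapRingHom] using h1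
  -- specialise the `R'`-point `(c)_c` to an `F`-point
  obtain ⟨ψ, hψ⟩ := exists_algHom_of_injective hF hR' χ
  have hcoeffF : ∀ m : Fin n →₀ ℕ,
      ψ (Ψ.eval.coeff m) = algebraMap R F (MvPolynomial.coeff m f) := by
    intro m
    have h0 :
        χ (Ψ.eval.coeff m - algebraMap R (MvPolynomial ↥s R) (MvPolynomial.coeff m f)) = 0 := by
      rw [map_sub, hcoeff m, AlgHom.commutes, sub_self]
    have h1 := hψ _ h0
    rwa [map_sub, AlgHom.commutes, sub_eq_zero] at h1
  refine ⟨Ψ.map ψ, ?_, by simp [Ψ]⟩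
  rw [NCFormula.eval_map]
  refine AddMonoidAlgebra.ext (Finsupp.ext fun m => ?_)
  rw [AddMonoidAlgebra.coeff_mapRingHom, coeff_baseChange, RingHom.coe_coe, hcoeffF m]

/-- **`L_F(f) ≤ L_{R'}(f)`** for `R ⊆ F` algebraically closed and `R ⊆ R'` commutative.
[cite: HrubesYehudayoff2011, Thm. 3.4] -/
theorem ncFormulaSize_baseChange_le_of_comm (hF : Function.Injective (algebraMap R F))
    (hR' : Function.Injective (algebraMap R R')) (f : MvPolynomial (Fin n) R) :
    ncFormulaSize (baseChange F f) ≤ ncFormulaSize (baseChange R' f) := by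
  obtain ⟨Φ₀, h₀⟩ := NCFormula.exists_eval_eq (baseChange R' f)
  have hne : {s | ∃ φ : NCFormula R' (Fin n), φ.eval = baseChange R' f ∧ φ.size = s}.Nonempty :=
    ⟨Φ₀.size, Φ₀, h₀, rfl⟩
  obtain ⟨Φ, hΦ, hs⟩ := Nat.sInf_mem hne
  obtain ⟨Φ', hΦ', hsize⟩ := exists_ncFormula_baseChange_of_comm hF hR' f Φ hΦ
  calc ncFormulaSize (baseChange F f) ≤ Φ'.size := ncFormulaSize_le_size Φ' hΦ'
    _ = Φ.size := hsize
    _ = ncFormulaSize (baseChange R' f) := hs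

end Transfer

/-- **Hrubeš–Yehudayoff 2011, Thm. 3.4 (formula half) holds**: over an algebraically closed
field `F`, for a subring `R ⊆ F` and any commutative ring `R' ⊇ R`, `L_F(f) ≤ L_{R'}(f)` for
every `f ∈ R[X]`. [cite: HrubesYehudayoff2011, Thm. 3.4] -/
theorem HrubesYehudayoff2011_thm34_formulas_holds : HrubesYehudayoff2011_thm34_formulas.{u} :=
  fun _R _F _ _ _ _ hF _R' _ _ hR' _n f => ncFormulaSize_baseChange_le_of_comm hF hR' f

end

end Literature.Barriers.ValiantsHypothesis
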